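import Mathlib
import Literature.NumberTheory.DiophantineGeometry.NoncriticalBelyiProtect
import Literature.NumberTheory.DiophantineGeometry.GenEllPullbackConductor

/-!
# Noncritical Belyi maps on `ℙ¹_ℚ` as integral `P1FiniteMap`s

[NCBelyi] Thm. 2.5 in genus `0` [cite: MochizukiNCBelyi2004] / Scherr–Zieve Thm. 1 for `C = ℙ¹`
[cite: ScherrZieve2014], in the form the tree's [GenEll] Prop. 1.7 (i) machinery consumes:
`GenEll.P1FiniteMap` (`GenEllPullbackConductor.lean`) is a finite map `φ = (f : g) : ℙ¹_ℚ → ℙ¹_ℚ`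
given by `f, g ∈ ℤ[t]` and the common degree `n` of the forms.  Clearing denominators in a
rational pair `(p, q)` — both polynomials are multiplied by the SAME nonzero integer `D`
(private `exists_p1FiniteMap_of_pair`), so `β = f/g` and every clause of the noncritical Belyi pairs of
`NoncriticalBelyiGenusZero.lean` / `NoncriticalBelyiProtect.lean` is unchanged — gives

* `NoncriticalBelyi.exists_p1FiniteMap_noncritical_infty`: for every finite set `A` of algebraic
  numbers a `P1FiniteMap φ` with `deg f = deg g = deg (f − g) = φ.deg = n ≥ 1`, `f, g` coprime in
  `ℚ[t]`, `β(∞) ∉ {0,1,∞}` and `β` unramified at `∞` (`f_{n−1} g_n ≠ f_n g_{n−1}`), the Belyi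
  clause at finite non-poles, `β(A) ⊆ {0, 1, ∞}`, and `#β⁻¹{0,1,∞} = n + 2` distinct complex
  roots of `f·g·(f − g)` (the support of `φ.pullbackCusps` over `ℚ̄`);
* `NoncriticalBelyi.exists_p1FiniteMap_noncritical_protect`: the same, protecting in addition the
  roots of any nonzero `G ∈ ℚ[t]` without roots in `A` (`β(γ) ∉ {0,1,∞}`, `β` unramified at `γ`).

No definitions, no named facts.
-/

namespace Literature.NumberTheory.DiophantineGeometry

open Polynomial Finset

namespace NoncriticalBelyi

/-- **Clearing denominators.** A pair `p, q ∈ ℚ[t]` of exact degree `n` is `D⁻¹·(f, g)` for a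
`GenEll.P1FiniteMap` `(f : g)` of degree `n` and a single nonzero constant `D`. [folklore] -/
private theorem exists_p1FiniteMap_of_pair {p q : ℚ[X]} {n : ℕ} (hp : p.natDegree = n)
    (hq : q.natDegree = n) :
    ∃ (φ : GenEll.P1FiniteMap) (D : ℚ), D ≠ 0 ∧ φ.deg = n ∧
      φ.num.map (Int.castRingHom ℚ) = C D * p ∧ φ.den.map (Int.castRingHom ℚ) = C D * q := by
  obtain ⟨bp, hbpM, hbp⟩ := IsLocalization.integerNormalization_spec (nonZeroDivisors ℤ) p
  obtain ⟨bq, hbqM, hbq⟩ := IsLocalization.integerNormalization_spec (nonZeroDivisors ℤ) q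
  set P₀ : ℤ[X] := IsLocalization.integerNormalization (nonZeroDivisors ℤ) p with hP₀
  set Q₀ : ℤ[X] := IsLocalization.integerNormalization (nonZeroDivisors ℤ) q with hQ₀
  have hbp0 : bp ≠ 0 := mem_nonZeroDivisors_iff_ne_zero.1 hbpM
  have hbq0 : bq ≠ 0 := mem_nonZeroDivisors_iff_ne_zero.1 hbqM
  set D : ℤ := bp * bq with hD
  have hD0 : (D : ℚ) ≠ 0 := by rw [hD]; exact_mod_cast mul_ne_zero hbp0 hbq0
  set P : ℤ[X] := C bq * P₀ with hP
  set Q : ℤ[X] := C bp * Q₀ with hQ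
  have hPmap : P.map (Int.castRingHom ℚ) = C (D : ℚ) * p := by
    rw [hP, Polynomial.map_mul, map_C, ← algebraMap_int_eq, hbp, ← Int.cast_smul_eq_zsmul ℚ bp p,
      smul_eq_C_mul, hD]
    simp only [algebraMap_int_eq, eq_intCast, Int.cast_mul, C_mul]; ring
  have hQmap : Q.map (Int.castRingHom ℚ) = C (D : ℚ) * q := by
    rw [hQ, Polynomial.map_mul, map_C, ← algebraMap_int_eq, hbq, ← Int.cast_smul_eq_zsmul ℚ bq q,
      smul_eq_C_mul, hD]
    simp only [algebraMap_int_eq, eq_intCast, Int.cast_mul, C_mul]; ring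
  clear_value P Q
  have hinj : Function.Injective (Int.castRingHom ℚ) := (Int.castRingHom ℚ).injective_int
  have hPdeg : P.natDegree = n := by
    rw [← natDegree_map_eq_of_injective hinj, hPmap, natDegree_C_mul hD0, hp]
  have hQdeg : Q.natDegree = n := by
    rw [← natDegree_map_eq_of_injective hinj, hQmap, natDegree_C_mul hD0, hq]
  exact ⟨⟨P, Q, n, hPdeg.le, hQdeg.le⟩, D, hD0, rfl, hPmap, hQmap⟩

/-- Values of an integral form whose image in `ℚ[t]` is `D·f`. [folklore] -/
private theorem aeval_of_map_eq {F : ℤ[X]} {f : ℚ[X]} {D : ℚ} (h : F.map (Int.castRingHom ℚ) = C D * f)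
    {K : Type*} [Field K] [Algebra ℚ K] (z : K) :
    aeval z F = algebraMap ℚ K D * aeval z f := by
  rw [← aeval_map_algebraMap ℚ z F, algebraMap_int_eq, h, map_mul, aeval_C]

/-- The Wronskian of integral forms `(D·f, D·g)` is `D²` times that of `(f, g)`. [folklore] -/
private theorem wronskian_map_of_map_eq {F G : ℤ[X]} {f g : ℚ[X]} {D : ℚ}
    (hF : F.map (Int.castRingHom ℚ) = C D * f) (hG : G.map (Int.castRingHom ℚ) = C D * g) :
    (derivative F * G - F * derivative G).map (Int.castRingHom ℚ) =
      C (D * D) * (derivative f * g - f * derivative g) := by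
  rw [Polynomial.map_sub, Polynomial.map_mul, Polynomial.map_mul, ← derivative_map,
    ← derivative_map, hF, hG, derivative_mul, derivative_mul, derivative_C, zero_mul, zero_add,
    zero_mul, zero_add, map_mul]
  ring

/-- Integralization `(f, g) = D·(p, q)` preserves the clause bundle of a noncritical Belyi pair:
degrees, non-ramification at `∞`, coprimality, the Belyi clause, cusp values (in any field) and
the count of `β⁻¹{0,1,∞}`. [folklore] -/
private theorem transport {p q : ℚ[X]} {n : ℕ} {D : ℚ} (hD : D ≠ 0) (φ : GenEll.P1FiniteMap)
    (hdeg : φ.deg = n) (hP : φ.num.map (Int.castRingHom ℚ) = C D * p)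
    (hQ : φ.den.map (Int.castRingHom ℚ) = C D * q)
    (hn : 0 < n) (hp : p.natDegree = n) (hq : q.natDegree = n) (hpq : (p - q).natDegree = n)
    (hunr : p.coeff (n - 1) * q.coeff n ≠ p.coeff n * q.coeff (n - 1)) (hcop : IsCoprime p q)
    (hcrit : ∀ z : ℂ, aeval z q ≠ 0 → aeval z (derivative p * q - p * derivative q) = 0 →
      aeval z p = 0 ∨ aeval z p = aeval z q)
    (hcard : ((p * q * (p - q)).map (algebraMap ℚ ℂ)).roots.toFinset.card = n + 2) :
    0 < φ.deg ∧ φ.num.natDegree = φ.deg ∧ φ.den.natDegree = φ.deg ∧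
      (φ.num - φ.den).natDegree = φ.deg ∧
      φ.num.coeff (φ.deg - 1) * φ.den.coeff φ.deg ≠ φ.num.coeff φ.deg * φ.den.coeff (φ.deg - 1) ∧
      IsCoprime (φ.num.map (Int.castRingHom ℚ)) (φ.den.map (Int.castRingHom ℚ)) ∧
      (∀ z : ℂ, aeval z φ.den ≠ 0 →
        aeval z (derivative φ.num * φ.den - φ.num * derivative φ.den) = 0 →
          aeval z φ.num = 0 ∨ aeval z φ.num = aeval z φ.den) ∧
      (∀ {K : Type} [Field K] [Algebra ℚ K] (a : K), aeval a (p * q * (p - q)) = 0 →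
        aeval a (φ.num * φ.den * (φ.num - φ.den)) = 0) ∧
      ((φ.num * φ.den * (φ.num - φ.den)).map (Int.castRingHom ℂ)).roots.toFinset.card =
        φ.deg + 2 := by
  subst hdeg
  have hinj : Function.Injective (Int.castRingHom ℚ) := (Int.castRingHom ℚ).injective_int
  have hPdeg : φ.num.natDegree = φ.deg := by
    rw [← natDegree_map_eq_of_injective hinj, hP, natDegree_C_mul hD, hp]
  have hQdeg : φ.den.natDegree = φ.deg := by
    rw [← natDegree_map_eq_of_injective hinj, hQ, natDegree_C_mul hD, hq]
  have hPQdeg : (φ.num - φ.den).natDegree = φ.deg := by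
    rw [← natDegree_map_eq_of_injective hinj, Polynomial.map_sub, hP, hQ, ← mul_sub,
      natDegree_C_mul hD, hpq]
  have hPcoeff : ∀ i, (φ.num.coeff i : ℚ) = D * p.coeff i := by
    intro i
    have := congrArg (fun F : ℚ[X] => F.coeff i) hP
    simpa [coeff_map, coeff_C_mul] using this
  have hQcoeff : ∀ i, (φ.den.coeff i : ℚ) = D * q.coeff i := by
    intro i
    have := congrArg (fun F : ℚ[X] => F.coeff i) hQ
    simpa [coeff_map, coeff_C_mul] using this
  have hDC : (algebraMap ℚ ℂ) D ≠ 0 := by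
    rw [map_ne_zero_iff _ (algebraMap ℚ ℂ).injective]; exact hD
  have hPz : ∀ z : ℂ, aeval z φ.num = algebraMap ℚ ℂ D * aeval z p := fun z => aeval_of_map_eq hP z
  have hQz : ∀ z : ℂ, aeval z φ.den = algebraMap ℚ ℂ D * aeval z q := fun z => aeval_of_map_eq hQ z
  have hWmap := wronskian_map_of_map_eq hP hQ
  refine ⟨hn, hPdeg, hQdeg, hPQdeg, ?_, ?_, ?_, ?_, ?_⟩
  · -- unramified at `∞`
    intro h
    apply hunr
    have h' := congrArg (fun x : ℤ => (x : ℚ)) h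
    simp only [Int.cast_mul, hPcoeff, hQcoeff] at h'
    have hD2 : D * D ≠ 0 := mul_ne_zero hD hD
    exact mul_left_cancel₀ hD2 (by linear_combination h')
  · -- coprime over `ℚ`
    rw [hP, hQ]
    have hu : IsCoprime (C D) (C D * q) :=
      ⟨C D⁻¹, 0, by rw [zero_mul, add_zero, ← C_mul, inv_mul_cancel₀ hD, C_1]⟩
    have hu' : IsCoprime p (C D) :=
      ⟨0, C D⁻¹, by rw [zero_mul, zero_add, ← C_mul, inv_mul_cancel₀ hD, C_1]⟩
    exact hu.mul_left (hu'.mul_right hcop)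
  · -- Belyi clause
    intro z hqz hWz
    rw [hQz] at hqz
    have hqz' : aeval z q ≠ 0 := fun h => hqz (by rw [h, mul_zero])
    rw [aeval_of_map_eq hWmap z, map_mul, mul_eq_zero, mul_eq_zero] at hWz
    rcases hWz with (h | h) | h
    · exact absurd h hDC
    · exact absurd h hDC
    rw [hPz, hQz]
    rcases hcrit z hqz' h with h1 | h1
    · left; rw [h1, mul_zero]
    · right; rw [h1]
  · -- cusp values, in any field over `ℚ`
    intro K _ _ a ha
    rw [map_mul, map_mul, map_sub] at ha ⊢
    rw [aeval_of_map_eq hP a, aeval_of_map_eq hQ a, ← mul_sub,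
      show algebraMap ℚ K D * aeval a p * (algebraMap ℚ K D * aeval a q) *
        (algebraMap ℚ K D * (aeval a p - aeval a q)) = (algebraMap ℚ K D) ^ 3 *
        (aeval a p * aeval a q * (aeval a p - aeval a q)) by ring, ha, mul_zero]
  · -- the count
    have hmapQ : (φ.num * φ.den * (φ.num - φ.den)).map (Int.castRingHom ℚ) =
        C (D ^ 3) * (p * q * (p - q)) := by
      rw [Polynomial.map_mul, Polynomial.map_mul, Polynomial.map_sub, hP, hQ, map_pow]; ring
    have h1 : (φ.num * φ.den * (φ.num - φ.den)).map (Int.castRingHom ℂ) =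
        ((φ.num * φ.den * (φ.num - φ.den)).map (Int.castRingHom ℚ)).map (algebraMap ℚ ℂ) := by
      rw [Polynomial.map_map]; congr 1
    rw [h1, hmapQ, Polynomial.map_mul, map_C, roots_C_mul _ (by
      rw [map_ne_zero_iff _ (algebraMap ℚ ℂ).injective]; exact pow_ne_zero _ hD)]
    exact hcard

/-- **Noncritical Belyi map on `ℙ¹_ℚ` protecting `∞`, integral form** (`GenEll.P1FiniteMap`):
see the module docstring. [cite: MochizukiNCBelyi2004, Thm 2.5] -/
theorem exists_p1FiniteMap_noncritical_infty (A : Finset ℂ) (hA : ∀ a ∈ A, IsAlgebraic ℚ a) :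
    ∃ φ : GenEll.P1FiniteMap, 0 < φ.deg ∧ φ.num.natDegree = φ.deg ∧ φ.den.natDegree = φ.deg ∧
      (φ.num - φ.den).natDegree = φ.deg ∧
      φ.num.coeff (φ.deg - 1) * φ.den.coeff φ.deg ≠ φ.num.coeff φ.deg * φ.den.coeff (φ.deg - 1) ∧
      IsCoprime (φ.num.map (Int.castRingHom ℚ)) (φ.den.map (Int.castRingHom ℚ)) ∧
      (∀ z : ℂ, aeval z φ.den ≠ 0 →
        aeval z (derivative φ.num * φ.den - φ.num * derivative φ.den) = 0 →
          aeval z φ.num = 0 ∨ aeval z φ.num = aeval z φ.den) ∧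
      (∀ a ∈ A, aeval a (φ.num * φ.den * (φ.num - φ.den)) = 0) ∧
      ((φ.num * φ.den * (φ.num - φ.den)).map (Int.castRingHom ℂ)).roots.toFinset.card =
        φ.deg + 2 := by
  obtain ⟨p, q, n, hn, hp, hq, hpq, hunr, hcop, hcrit, hval, hcard⟩ :=
    exists_belyi_noncritical_infty_card A hA
  obtain ⟨φ, D, hD, hdeg, hP, hQ⟩ := exists_p1FiniteMap_of_pair hp hq
  obtain ⟨h1, h2, h3, h4, h5, h6, h7, h8, h9⟩ :=
    transport hD φ hdeg hP hQ hn hp hq hpq hunr hcop hcrit hcard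
  exact ⟨φ, h1, h2, h3, h4, h5, h6, h7, fun a ha => h8 a (hval a ha), h9⟩

/-- **Noncritical Belyi map on `ℙ¹_ℚ` protecting `∞` and the roots of a nonzero `G ∈ ℚ[t]`,
integral form** (`GenEll.P1FiniteMap`): see the module docstring.
[cite: MochizukiNCBelyi2004, Thm 2.5] -/
theorem exists_p1FiniteMap_noncritical_protect (A : Finset ℂ) (hA : ∀ a ∈ A, IsAlgebraic ℚ a)
    (G : ℚ[X]) (hG : G ≠ 0) (hGA : ∀ a ∈ A, aeval a G ≠ 0) :
    ∃ φ : GenEll.P1FiniteMap, 0 < φ.deg ∧ φ.num.natDegree = φ.deg ∧ φ.den.natDegree = φ.deg ∧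
      (φ.num - φ.den).natDegree = φ.deg ∧
      φ.num.coeff (φ.deg - 1) * φ.den.coeff φ.deg ≠ φ.num.coeff φ.deg * φ.den.coeff (φ.deg - 1) ∧
      IsCoprime (φ.num.map (Int.castRingHom ℚ)) (φ.den.map (Int.castRingHom ℚ)) ∧
      (∀ z : ℂ, aeval z φ.den ≠ 0 →
        aeval z (derivative φ.num * φ.den - φ.num * derivative φ.den) = 0 →
          aeval z φ.num = 0 ∨ aeval z φ.num = aeval z φ.den) ∧
      (∀ a ∈ A, aeval a (φ.num * φ.den * (φ.num - φ.den)) = 0) ∧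
      (∀ {K : Type} [Field K] [Algebra ℚ K] (γ : K), aeval γ G = 0 →
        aeval γ φ.num ≠ 0 ∧ aeval γ φ.den ≠ 0 ∧ aeval γ φ.num ≠ aeval γ φ.den) ∧
      (∀ γ : ℂ, aeval γ G = 0 →
        aeval γ (derivative φ.num * φ.den - φ.num * derivative φ.den) ≠ 0) ∧
      ((φ.num * φ.den * (φ.num - φ.den)).map (Int.castRingHom ℂ)).roots.toFinset.card =
        φ.deg + 2 := by
  obtain ⟨p, q, n, hn, hp, hq, hpq, hunr, hcop, hcrit, hval, hprot, hW, hcard⟩ :=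
    exists_belyi_noncritical_protect A hA G hG hGA
  obtain ⟨φ, D, hD, hdeg, hP, hQ⟩ := exists_p1FiniteMap_of_pair hp hq
  obtain ⟨h1, h2, h3, h4, h5, h6, h7, h8, h9⟩ :=
    transport hD φ hdeg hP hQ hn hp hq hpq hunr hcop hcrit hcard
  refine ⟨φ, h1, h2, h3, h4, h5, h6, h7, fun a ha => h8 a (hval a ha), ?_, ?_, h9⟩
  · intro K _ _ γ hγ
    obtain ⟨hp0, hq0, hpq0⟩ := hprot γ hγ
    have hDK : algebraMap ℚ K D ≠ 0 := by
      rw [map_ne_zero_iff _ (algebraMap ℚ K).injective]; exact hD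
    rw [aeval_of_map_eq hP γ, aeval_of_map_eq hQ γ]
    exact ⟨mul_ne_zero hDK hp0, mul_ne_zero hDK hq0, fun h => hpq0 (mul_left_cancel₀ hDK h)⟩
  · intro γ hγ h
    have hDC : algebraMap ℚ ℂ D ≠ 0 := by
      rw [map_ne_zero_iff _ (algebraMap ℚ ℂ).injective]; exact hD
    rw [aeval_of_map_eq (wronskian_map_of_map_eq hP hQ) γ, map_mul, mul_eq_zero, mul_eq_zero] at h
    rcases h with (h | h) | h
    · exact hDC h
    · exact hDC h
    · exact hW γ hγ h

end NoncriticalBelyi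

end Literature.NumberTheory.DiophantineGeometry
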